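import Summits.ResolutionOfSingularities.ResolutionOfSingularities.Theorems.CrossCutLaw
import HarnessLib

/-!
# CrossCutLaw2 — decomp-res node «CrossCut» (lens-2 g20), file 2/3 of `CrossCutLaw`

Content VERBATIM from the decomp-res lens-2 g20 node `HOME/decomp-res-lens-2/g20/CrossCut.lean` (pin 9ac8d1ca, 4 409
l; HOME = run/shared/lean/pub/decomp-res);
CRITIC-LEDGER row 160 (+1); landing orders INBOX :600 (and lens INBOX :582): l. 112–3564 are `SpreadCut` b2959d31
VERBATIM (landed as `SpreadCutLaw…` · `SpreadCutCells` ·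
`MaxContactCutSpreadCut`) and are DELETED here with the landed modules imported instead (namespaces
`…Theorems.PinchCut` / `JetCut` / `PurityCut` / `SplitCut` / `CylinderCut` /
`SpreadCut` opened; same short names, byte-identical bodies — never two copies); NEW = §X (l. 3566–4407).  Namespace
`…Theorems.CrossCut` (the lens's `Theses.CrossCut` is
gate-reserved), sub-namespaces `Cross` / `Leaf` as in the lens (inside the re-entered `namespace Leaf` of §X.3 the
landed `…Theorems.PurityCut.Leaf` is opened so the g16
schema's short names resolve exactly as in the lens); file split only (tree files ≤ 400 lines): sections, variables,
the `open MvPolynomial` lines and every declaration exactly as in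
the lens; the node's global dupNamespace-linter line dropped.  Node files, in import order: `CrossCutLaw` (§X.0 ring
level; continued `…2`) · `CrossCutCells` (§X.2–§X.7
cone-free: the aside / port home; continued `…2`) · the wiring `MaxContactCutCrossCut` (§X BY NAME on the host
route, in the Theses cone).  All `--supports
stmt-ResolutionOfSingularities-29273` (`MaxContactCut.RungOne`); nothing closes 29273 — decided halves carry their
engines / ports as hypotheses (`CrossExit` is a paper engine);
exactly ONE located-residual aside on the lens-2 column (`Cross.CrossSpecialRung`) SUPERSEDES g19's
`Spread.SpreadSpecialRung`, re-located EXACTLY modulo the cross decided half,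
and `ComponentPackagePort` is the column's ONE port item.

§X.0 (NEW, g20): LAW (X) THE CROSS, ring level — the cross letters and chart kernels at the TANGLE point where the
δ-steep top curve meets the flank, `InsepVVKernel`; PROVED kernels, VERBATIM (continued `…2` where the 400-line cap cuts).

Part 2/3 carries: `monomial_mem_flankWt`, `flankWt_anti`, `crossWt`, `monomial_mem_crossWt`, `crossWt_anti`,
`crossWt_le_flankWt`, `crossWt_le_qWeighted`, `CrossShape`, `FlankShape`, `cross_towerOne`, `cross_wStep`,
`cross_vStep`, `cross_towerTwo`, `flank_tower`, `cross_terms_mem_crossWt`, `flank_terms_mem_flankWt`, `insepVV`, `crossFrame`.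

(Sources: Hironaka1964 Ch. III; CossartJannsenSaito2020 Ch. 2, Ch. 8–9; CossartPiltant2008 Prop. 4.2;
CossartPiltant2019 Rem. 3.2; BierstoneGrigorievMilmanWlodarczyk2011 §3.1; Moh1987; Hauser2010Kangaroo; Giraud1975;
Narasimhan1983.)
-/

open CategoryTheory AlgebraicGeometry TopologicalSpace IsLocalRing
open Literature.AlgebraicGeometry.Resolution
open Summit.ResolutionOfSingularities.ResolutionOfSingularities.Theorems
open Summit.ResolutionOfSingularities.ResolutionOfSingularities.Theorems.WeakOrderReduction
open Summit.ResolutionOfSingularities.ResolutionOfSingularities.Theorems.DeltaFaceCutClasses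
open Summit.ResolutionOfSingularities.ResolutionOfSingularities.Theorems.RelativeDeltaCut
open Summit.ResolutionOfSingularities.ResolutionOfSingularities.Theorems.CurveLeafExit
open Summit.ResolutionOfSingularities.ResolutionOfSingularities.Theorems.PinchCut
open Summit.ResolutionOfSingularities.ResolutionOfSingularities.Theorems.JetCut
open Summit.ResolutionOfSingularities.ResolutionOfSingularities.Theorems.PurityCut
open Summit.ResolutionOfSingularities.ResolutionOfSingularities.Theorems.SplitCut
open Summit.ResolutionOfSingularities.ResolutionOfSingularities.Theorems.CylinderCut
open Summit.ResolutionOfSingularities.ResolutionOfSingularities.Theorems.SpreadCut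
open MvPolynomial

namespace Summit.ResolutionOfSingularities.ResolutionOfSingularities.Theorems.CrossCut

section CrossRing

variable {R : Type} [CommRing R]

/-- Monomials of enough flank weight lie in the flank ideal.  KERNEL (PROVED). [folklore] -/
theorem monomial_mem_flankWt (z u v : R) (q l i j k : ℕ) (h : l ≤ q * i + j + q * k) :
    z ^ i * u ^ j * v ^ k ∈ flankWt z u v q l :=
  Ideal.subset_span ⟨i, j, k, h, rfl⟩

/-- The flank ideals DECREASE with the threshold.  KERNEL (PROVED). [folklore] -/
theorem flankWt_anti (z u v : R) (q : ℕ) {l l' : ℕ} (h : l ≤ l') : flankWt z u v q l' ≤ flankWt z u v q l := by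
  apply Ideal.span_mono
  rintro x ⟨i, j, k, hw, rfl⟩
  exact ⟨i, j, k, le_trans h hw, rfl⟩

/-- **THE CROSS WEIGHT** [g20] (`crossWt c q λ₁ λ₂`, frame `c = (z, u₁, u₂, v)`, `m = 2q + 1`): the ideal generated
by the monomials
`zⁱ u₁ᵃ u₂ᵇ vᵉ` carrying BOTH weights at once — the SPREAD weight `W₁ = m·i + 2(a + b) ≥ λ₁` of the steep branch `C₁
= V(z, u₁, u₂)` (g19's
δ-weight `z ↦ m`, `u_j ↦ n = 2`, `v ↦ 0`; on its generators `crossWt ⊆ qWeighted (z,u₁,u₂) m 2 λ₁`) and the FLANK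
weight `W₂ = q·i + a + q·e ≥ λ₂`
of the flat branch `C₂ = V(z, u₁, v)` (`u₂ ↦ 0`; `crossWt ⊆ flankWt z u₁ v q λ₂`, kernel `crossWt_le_flankWt`).  One
doubly-weighted
monomial ideal (rather than an intersection of two monomial ideals) keeps the chart bookkeeping of §X.1 literally
monomial-by-monomial in
every regular local ring.  DEFINITION (NEW object). (Sources: Hironaka1967; CossartJannsenSaito2020 Ch. 8;
CossartPiltant2019 Prop. 2.6.) -/
def crossWt (c : Fin 4 → R) (q l₁ l₂ : ℕ) : Ideal R :=
  Ideal.span {x | ∃ i a b e : ℕ, l₁ ≤ (2 * q + 1) * i + 2 * (a + b) ∧ l₂ ≤ q * i + a + q * e ∧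
    x = c 0 ^ i * c 1 ^ a * c 2 ^ b * c 3 ^ e}

/-- Monomials carrying both weights lie in the cross ideal.  KERNEL (PROVED). [folklore] -/
theorem monomial_mem_crossWt (c : Fin 4 → R) (q l₁ l₂ i a b e : ℕ) (h₁ : l₁ ≤ (2 * q + 1) * i + 2 * (a + b))
    (h₂ : l₂ ≤ q * i + a + q * e) : c 0 ^ i * c 1 ^ a * c 2 ^ b * c 3 ^ e ∈ crossWt c q l₁ l₂ :=
  Ideal.subset_span ⟨i, a, b, e, h₁, h₂, rfl⟩

/-- The cross ideals DECREASE with either threshold.  KERNEL (PROVED). [folklore] -/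
theorem crossWt_anti (c : Fin 4 → R) (q : ℕ) {l₁ l₁' l₂ l₂' : ℕ} (h₁ : l₁ ≤ l₁') (h₂ : l₂ ≤ l₂') :
    crossWt c q l₁' l₂' ≤ crossWt c q l₁ l₂ := by
  apply Ideal.span_mono
  rintro x ⟨i, a, b, e, hw₁, hw₂, rfl⟩
  exact ⟨i, a, b, e, le_trans h₁ hw₁, le_trans h₂ hw₂, rfl⟩

/-- The cross ideal lies in the flank ideal of the flat branch (forget the spread weight; `u₂` is a coefficient).
KERNEL (PROVED).
[folklore] -/
theorem crossWt_le_flankWt (c : Fin 4 → R) (q l₁ l₂ : ℕ) : crossWt c q l₁ l₂ ≤ flankWt (c 0) (c 1) (c 3) q l₂ := by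
  apply Ideal.span_le.mpr
  rintro x ⟨i, a, b, e, -, h₂, rfl⟩
  have h := monomial_mem_flankWt (c 0) (c 1) (c 3) q l₂ i a e h₂
  have h' : c 0 ^ i * c 1 ^ a * c 2 ^ b * c 3 ^ e = c 2 ^ b * (c 0 ^ i * c 1 ^ a * c 3 ^ e) := by ring
  rw [SetLike.mem_coe, h']
  exact Ideal.mul_mem_left _ _ h

/-- The cross ideal lies in the tree's δ-weight ideal `qWeighted (z, u₁, u₂) m 2 λ₁` of the steep branch (forget the
flank weight; `v` is a
coefficient) — the spread side of the letter is g19's.  KERNEL (PROVED). [folklore] -/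
theorem crossWt_le_qWeighted (c : Fin 4 → R) (q l₁ l₂ : ℕ) :
    crossWt c q l₁ l₂ ≤ qWeighted ![c 0, c 1, c 2] (2 * q + 1) 2 l₁ := by
  apply Ideal.span_le.mpr
  rintro x ⟨i, a, b, e, h₁, -, rfl⟩
  let m : Fin 3 →₀ ℕ := Finsupp.equivFunOnFinite.symm ![i, a, b]
  have hm0 : m 0 = i := by simp [m]
  have hm1 : m 1 = a := by simp [m]
  have hm2 : m 2 = b := by simp [m]
  have hmon : cMon ![c 0, c 1, c 2] m = c 0 ^ i * c 1 ^ a * c 2 ^ b := by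
    rw [cMon, Finsupp.prod_fintype _ _ (fun j => pow_zero _), Fin.prod_univ_three, hm0, hm1, hm2]
    simp
  have hw : l₁ ≤ wdeg (2 * q + 1) 2 m := by
    have hu : uDeg m = a + b := by
      simp only [uDeg, Fin.sum_univ_two, Fin.succ_zero_eq_one, Fin.succ_one_eq_two, hm1, hm2]
    rw [wdeg, hu, hm0]
    exact h₁
  have hmem : cMon ![c 0, c 1, c 2] m ∈ qWeighted ![c 0, c 1, c 2] (2 * q + 1) 2 l₁ :=
    Ideal.subset_span ⟨m, hw, rfl⟩
  have h' : c 0 ^ i * c 1 ^ a * c 2 ^ b * c 3 ^ e = c 3 ^ e * cMon ![c 0, c 1, c 2] m := by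
    rw [hmon]; ring
  rw [SetLike.mem_coe, h']
  exact Ideal.mul_mem_left _ _ hmem

/-- **CROSS SHAPE** [g20] (`CrossShape J c q`), the letter AT A TANGLE POINT `y` in the frame `c = (z, u₁, u₂, v)`
(`(z,u₁,u₂)` cutting
out the steep branch `C₁`, `(z,u₁,v)` the flat branch `C₂`): a member
`f = z² + ε₁·u₁^m + ε₂·v²·u₂^m + g ∈ J`, `m = 2q + 1` (`q ≥ 1` in the uniform class), `ε₁, ε₂` UNITS, the tail `g`
strictly above BOTH
faces (`g ∈ crossWt c q (2m+1) (2q+1)`: spread weight `≥ 2m + 1`, flank weight `≥ 2q + 1`), and the WHOLE ideal deep for both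
(`J ⊆ crossWt c q (2m) (2q)`: permissibility of every centre of the package for every member, §X.1 (P)).  The three
displayed terms have
weights `(2m, 2q)`, `(2m, m)`, `(2m, 2q)` (kernel `cross_terms_mem_crossWt`); `u₁^m·u₂`, `u₁^m·v`, `z²·u₂`, … are
absorbed into the units
(they carry the weights of the term they modify); `J` need NOT be principal.  DEFINITION (NEW class predicate, ring
level). (Sources: Hironaka1967; CossartJannsenSaito2020 Ch. 8; CossartPiltant2019 Def. 3.5.) -/
def CrossShape (J : Ideal R) (c : Fin 4 → R) (q : ℕ) : Prop :=
  ∃ e₁ e₂ g : R, IsUnit e₁ ∧ IsUnit e₂ ∧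
    g ∈ crossWt c q (2 * (2 * q + 1) + 1) (2 * q + 1) ∧
    c 0 ^ 2 + e₁ * c 1 ^ (2 * q + 1) + e₂ * c 3 ^ 2 * c 2 ^ (2 * q + 1) + g ∈ J ∧
    J ≤ crossWt c q (2 * (2 * q + 1)) (2 * q)

/-- **FLANK SHAPE** [g20] (`FlankShape J M P c q`), the letter at a closed point of the FLAT BRANCH `C₂` AWAY FROM
THE STEEP BRANCH, frame
`c = (z, u₁, v, t)` with `P = (z, u₁, v)` the prime of `C₂` and `t` inert: a member `f = z² + μ·v² + ε₁·u₁^m + g ∈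
J` with `ε₁` a unit, the
PINCH COEFFICIENT `μ ∈ M = 𝔪_y` RESTRICTING TO A UNIFORMISER of `𝒪_{C₂,y} = R/P` (`μ ∉ M² + P`), tail `g ∈ flankWt z
u₁ v q (2q+2)`
(strictly above the flank face AND above `u₁^m`: a bare `c·u₁^m`, which could cancel the transversal term, is
excluded; `u₁^{m}·t`,
`u₁^{m+1}`, … are absorbed into `ε₁`), whole ideal `J ⊆ flankWt … (2q)`.  (For a prepared flat double curve `z² +
λv² + …` with `λ̄` a unit
NOT a square in `k(y)`, `τ(y) = 2` already — class ≥ 2; with `λ̄ = ᾱ²` re-prepare `z ↦ z + α̃v`.)  DEFINITION (NEW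
class predicate, ring
level). (Sources: Hironaka1967; CossartJannsenSaito2020 Ch. 2, Ch. 8; CossartPiltant2019 Def. 3.5.) -/
def FlankShape (J M P : Ideal R) (c : Fin 4 → R) (q : ℕ) : Prop :=
  ∃ μ e₁ g : R, IsUnit e₁ ∧ μ ∈ M ∧ μ ∉ M ^ 2 ⊔ P ∧
    g ∈ flankWt (c 0) (c 1) (c 2) q (2 * q + 2) ∧
    c 0 ^ 2 + μ * c 2 ^ 2 + e₁ * c 1 ^ (2 * q + 1) + g ∈ J ∧
    J ≤ flankWt (c 0) (c 1) (c 2) q (2 * q)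

section CrossKernel

/-- **THE SPREAD TOWER ALONG THE TANGLE BRANCH** [g20; KERNEL (PROVED): cumulative chart identity]: in the
`u₂`-branch of the `q` steps
`C₁, Σ₁, …, Σ_{q−1}` (`z = Z·u^q`, `u₁ = w·u`, `u₂ = u`) the cross member becomes `u^{2q}·(Z² + u·(ε₁w^m + ε₂v²))`:
at the point `x_q`
over `y` the flat branch `C₂^(q) = V(Z, w, v)` carries the SUB-FLAT pinch face `Z² + (ε₂u)·v²` of inert depth `1`. [folklore] -/
theorem cross_towerOne (Z u w v e₁ e₂ : R) (q : ℕ) :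
    (Z * u ^ q) ^ 2 + e₁ * (w * u) ^ (2 * q + 1) + e₂ * v ^ 2 * u ^ (2 * q + 1) =
      u ^ (2 * q) * (Z ^ 2 + u * (e₁ * w ^ (2 * q + 1) + e₂ * v ^ 2)) := by
  ring

/-- **ONE STEP OF THE FLANK TOWER, `w`-chart** [g20; KERNEL (PROVED)]: blowing up `V(Z, w, V)` (`Z ↦ Z·w`, `V ↦ V·w`) lowers the
transversal exponent of `w` by `2` and keeps the shape. [folklore] -/
theorem cross_wStep (Z u w V e₁ e₂ : R) (e : ℕ) :
    (Z * w) ^ 2 + u * (e₁ * w ^ (e + 2) + e₂ * (V * w) ^ 2) = w ^ 2 * (Z ^ 2 + u * (e₁ * w ^ e + e₂ * V ^ 2)) := by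
  ring

/-- **ONE STEP OF THE FLANK TOWER, `V`-chart** [g20; KERNEL (PROVED)]: (`Z ↦ Z·V`, `w ↦ w·V`) the pinch coefficient
`ε₂·u` becomes a
TERM — order `≤ 1` over `y` (where `u` is a parameter), and over `η₂` the fibre polynomial `T² + ε̄₂ū` is
Eisenstein. [folklore] -/
theorem cross_vStep (Z u w V e₁ e₂ : R) (e : ℕ) :
    (Z * V) ^ 2 + u * (e₁ * (w * V) ^ (e + 2) + e₂ * V ^ 2) =
      V ^ 2 * (Z ^ 2 + e₂ * u + u * e₁ * w ^ (e + 2) * V ^ e) := by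
  ring

/-- **THE FLANK TOWER ALONG THE TANGLE BRANCH** [g20; KERNEL (PROVED): cumulative chart identity]: in the `w`-branch
of the `q` steps
`C₂^(q), Σ′₁, …, Σ′_{q−1}` (`Z = Z′·w^q`, `v = V·w^q`) the stage-`q` member becomes `w^{2q}·(Z′² + u·(ε₁w + ε₂V²))`,
whose initial form at
the last point `x_{2q}` is `Z′² + ε̄₁·U·W` — an irreducible quadric in three variables: `τ = 3`, EXIT. [folklore] -/
theorem cross_towerTwo (Z' u w V e₁ e₂ : R) (q : ℕ) :
    (Z' * w ^ q) ^ 2 + u * (e₁ * w ^ (2 * q + 1) + e₂ * (V * w ^ q) ^ 2) =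
      w ^ (2 * q) * (Z' ^ 2 + u * (e₁ * w + e₂ * V ^ 2)) := by
  ring

/-- **THE FLANK TOWER AT A FLANK POINT** [g20; KERNEL (PROVED): cumulative chart identity]: in the `u₁`-branch of the `q` steps
`C₂, Σ′₁, …, Σ′_{q−1}` (`z = Z·u₁^q`, `v = V·u₁^q`) the flank member becomes `u₁^{2q}·(Z² + μV² + ε₁u₁)` — order `1`
at the last point
(the transversal term `ε₁u₁` is linear), EXIT by order drop. [folklore] -/
theorem flank_tower (Z u₁ V μ e₁ : R) (q : ℕ) :
    (Z * u₁ ^ q) ^ 2 + μ * (V * u₁ ^ q) ^ 2 + e₁ * u₁ ^ (2 * q + 1) = u₁ ^ (2 * q) * (Z ^ 2 + μ * V ^ 2 + e₁ * u₁) := by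
  ring

/-- The three displayed terms of a cross member carry both weights: `z²`, `ε₁u₁^m`, `ε₂v²u₂^m ∈ crossWt c q (2m)
(2q)` (spread weights
`2m, 2m, 2m`; flank weights `2q, m, 2q`).  KERNEL (PROVED; letter bookkeeping). [folklore] -/
theorem cross_terms_mem_crossWt (c : Fin 4 → R) (e₁ e₂ : R) (q : ℕ) :
    c 0 ^ 2 + e₁ * c 1 ^ (2 * q + 1) + e₂ * c 3 ^ 2 * c 2 ^ (2 * q + 1) ∈ crossWt c q (2 * (2 * q + 1)) (2 * q) := by
  refine Ideal.add_mem _ (Ideal.add_mem _ ?_ ?_) ?_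
  · have h := monomial_mem_crossWt c q (2 * (2 * q + 1)) (2 * q) 2 0 0 0 (by ring_nf; omega) (by omega)
    simpa using h
  · have h := monomial_mem_crossWt c q (2 * (2 * q + 1)) (2 * q) 0 (2 * q + 1) 0 0 (by ring_nf; omega) (by omega)
    have h' : e₁ * c 1 ^ (2 * q + 1) = e₁ * (c 0 ^ 0 * c 1 ^ (2 * q + 1) * c 2 ^ 0 * c 3 ^ 0) := by ring
    rw [h']
    exact Ideal.mul_mem_left _ _ h
  · have h := monomial_mem_crossWt c q (2 * (2 * q + 1)) (2 * q) 0 0 (2 * q + 1) 2 (by ring_nf; omega) (by omega)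
    have h' : e₂ * c 3 ^ 2 * c 2 ^ (2 * q + 1) = e₂ * (c 0 ^ 0 * c 1 ^ 0 * c 2 ^ (2 * q + 1) * c 3 ^ 2) := by ring
    rw [h']
    exact Ideal.mul_mem_left _ _ h

/-- The displayed terms of a flank member carry the flank weight: `z²`, `μv²`, `ε₁u₁^m ∈ flankWt z u₁ v q (2q)`
(weights `2q, 2q, m`).
KERNEL (PROVED; letter bookkeeping). [folklore] -/
theorem flank_terms_mem_flankWt (z u₁ v μ e₁ : R) (q : ℕ) :
    z ^ 2 + μ * v ^ 2 + e₁ * u₁ ^ (2 * q + 1) ∈ flankWt z u₁ v q (2 * q) := by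
  refine Ideal.add_mem _ (Ideal.add_mem _ ?_ ?_) ?_
  · have h := monomial_mem_flankWt z u₁ v q (2 * q) 2 0 0 (by omega)
    simpa using h
  · have h := monomial_mem_flankWt z u₁ v q (2 * q) 0 0 2 (by omega)
    have h' : μ * v ^ 2 = μ * (z ^ 0 * u₁ ^ 0 * v ^ 2) := by ring
    rw [h']
    exact Ideal.mul_mem_left _ _ h
  · have h := monomial_mem_flankWt z u₁ v q (2 * q) 0 (2 * q + 1) 0 (by omega)
    have h' : e₁ * u₁ ^ (2 * q + 1) = e₁ * (z ^ 0 * u₁ ^ (2 * q + 1) * v ^ 0) := by ring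
    rw [h']
    exact Ideal.mul_mem_left _ _ h

end CrossKernel

end CrossRing

section InsepVVKernel

open MvPolynomial

/-- **THE TANGLE INHABITANT** [g20]: INSEP-vv = `(z + v(u₁+u₂))² + u₁⁵ + v²·u₂⁵ + u₂⁷ ∈ 𝔽₂[z, v, u₁, u₂]` (variables
`0, 1, 2, 3` as in
g19's `insepV`; NODE-g19 §4 (Q4)/§7: spread-special — a SECOND top curve through the core).  DEFINITION (support,
the bed). [folklore] -/
noncomputable def insepVV : MvPolynomial (Fin 4) (ZMod 2) :=
  (X 0 + X 1 * (X 2 + X 3)) ^ 2 + X 2 ^ 5 + X 1 ^ 2 * X 3 ^ 5 + X 3 ^ 7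

/-- **THE CROSS FRAME of INSEP-vv** [g20]: `(z′, u₁, u₂, b) = (z + v(u₁+u₂), u₁, u₂, v + u₂)` — a minimal system of the origin
(triangular in `(z, u₁, u₂, v)`).  DEFINITION (support). [folklore] -/
noncomputable def crossFrame : Fin 4 → MvPolynomial (Fin 4) (ZMod 2) :=
  ![X 0 + X 1 * (X 2 + X 3), X 2, X 3, X 1 + X 3]

end InsepVVKernel

end Summit.ResolutionOfSingularities.ResolutionOfSingularities.Theorems.CrossCut
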